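import Literature.Combinatorics.Optimization.SymmetricSDPMatching
import Literature.Computability.Complexity.Mod2PerfectMatchings
import HarnessLib

/-!
# Low-degree functions on perfect matchings lift to low-degree polynomials (BBCHPRRWZ 2017, §4.2–4.3)

Functions on the perfect matchings `PM_n` of `K_n` (the tree's `PMSol n`,
`SymmetricSDPMatching.lean`) are restrictions of polynomials in the edge variables
(Braun–Brown-Cohen–Huq–Pokutta–Raghavendra–Roy–Weitz–Zink, Math. Program. 165 (2017), §4.2:
"the ring of real valued functions on perfect matchings is isomorphic to `ℝ[x]/⟨𝒫_n⟩` with `x_{uv}`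
representing the indicator function of the edge `uv` being contained in a perfect matching";
§4.3: "for a partial matching `M` let `x_M := Π_{e ∈ M} x_e`", Lemma 4.4: every polynomial is
congruent, without raising the degree, to a combination of the `x_M`). This file records the
degree filtration on the function side and its lift:

* `monomialFn Q` — the function `x_Q(M) = [Q ⊆ M]` on perfect matchings (`Q` a set of pairs);
* `polLE n k` — `Pol_{≤k}(PM_n)`, the span of the `x_Q` with `|Q| ≤ k`;
* `monomialPoly Q` — the monomial `Π_{q ∈ Q} x_q` for loop-free `Q`, of total degree `≤ |Q|`,
  restricting to `x_Q` (`eval_monomialPoly`); a `Q` containing a loop has `x_Q = 0`;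
* `polLELift` — **every `f ∈ Pol_{≤k}(PM_n)` is the restriction of a polynomial of total degree
  `≤ k`** (the cell's typed target `PolLELift`, HOME/pnp-psdrank-p2/TARGET.md, T-D.4).

## References

* G. Braun et al., *The matching problem has no small symmetric SDP*, Math. Program. 165 (2017)
  643–662, §4.2–4.3 (arXiv:1504.00703, pp. 7–8). [BraunEtAl2016]
-/

noncomputable section

open MvPolynomial Finset
open Literature.Computability.Complexity (KnEdge edgeIndicator edgeIndicator_apply)

namespace Literature.Combinatorics.Optimization

variable {n : ℕ}

/-! ### Monomial functions and the degree filtration -/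

/-- **The monomial function** `x_Q(M) = [Q ⊆ M]` on perfect matchings (`x_Q = Π_{e ∈ Q} x_e`
restricted to `PM_n`). [cite: BraunEtAl2016, §4.3 (p. 8, "x_M := Π_{e ∈ M} x_e")] -/
def monomialFn (Q : Finset (Sym2 (Fin n))) : PMSol n → ℝ :=
  fun M => if Q ⊆ M.1 then 1 else 0

/-- Unfolding. [cite: BraunEtAl2016, §4.3 (p. 8)] -/
theorem monomialFn_apply (Q : Finset (Sym2 (Fin n))) (M : PMSol n) :
    monomialFn Q M = if Q ⊆ M.1 then 1 else 0 := rfl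

/-- **`Pol_{≤k}(PM_n)`**: the functions on perfect matchings of degree `≤ k`, i.e. the span of
the monomial functions `x_Q`, `|Q| ≤ k`. [cite: BraunEtAl2016, §4.2–4.3 (pp. 7–8, degree of functions on matchings via ℝ[x]/⟨𝒫_n⟩ and Lemma 4.4)] -/
def polLE (n k : ℕ) : Submodule ℝ (PMSol n → ℝ) :=
  Submodule.span ℝ {f | ∃ Q : Finset (Sym2 (Fin n)), Q.card ≤ k ∧ f = monomialFn Q}

/-- A pair set containing a loop is contained in no perfect matching: `x_Q = 0`.
[cite: BraunEtAl2016, §4.3 (p. 8, Lemma 4.4: monomials not supported on a partial matching vanish)] -/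
theorem monomialFn_eq_zero_of_isDiag {Q : Finset (Sym2 (Fin n))} {q : Sym2 (Fin n)} (hq : q ∈ Q)
    (hd : q.IsDiag) : monomialFn Q = 0 := by
  funext M
  rw [monomialFn_apply, if_neg]
  · rfl
  · exact fun h => M.2.2.1 q (h hq) hd

/-- **The lifting monomial** `Π_{q ∈ Q} x_q` of a loop-free pair set `Q`, in the edge variables
of `K_n`. [cite: BraunEtAl2016, §4.3 (p. 8, "x_M := Π_{e ∈ M} x_e")] -/
def monomialPoly (Q : Finset (Sym2 (Fin n))) (hQ : ∀ q ∈ Q, ¬ q.IsDiag) :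
    MvPolynomial (KnEdge n) ℝ :=
  ∏ q ∈ Q.attach, X ⟨q.1, hQ q.1 q.2⟩

/-- Its total degree is at most `|Q|`. [cite: BraunEtAl2016, §4.3 (p. 8)] -/
theorem totalDegree_monomialPoly_le (Q : Finset (Sym2 (Fin n))) (hQ : ∀ q ∈ Q, ¬ q.IsDiag) :
    (monomialPoly Q hQ).totalDegree ≤ Q.card := by
  refine (totalDegree_finsetProd _ _).trans (le_of_eq ?_)
  calc ∑ q ∈ Q.attach, (X ⟨q.1, hQ q.1 q.2⟩ : MvPolynomial (KnEdge n) ℝ).totalDegree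
      = ∑ _q ∈ Q.attach, 1 := sum_congr rfl fun q _ => totalDegree_X _
    _ = Q.card := by rw [sum_const, smul_eq_mul, mul_one, card_attach]

/-- It restricts to `x_Q`: at `χ^M` it evaluates to `[Q ⊆ M]`. [cite: BraunEtAl2016, §4.2–4.3 (pp. 7–8)] -/
theorem eval_monomialPoly (Q : Finset (Sym2 (Fin n))) (hQ : ∀ q ∈ Q, ¬ q.IsDiag)
    (M : Finset (Sym2 (Fin n))) :
    eval (edgeIndicator M) (monomialPoly Q hQ) = if Q ⊆ M then 1 else 0 := by
  rw [monomialPoly, eval_prod]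
  simp_rw [eval_X, edgeIndicator_apply]
  rw [prod_boole]
  congr 1
  exact propext ⟨fun h q hq => h ⟨q, hq⟩ (mem_attach _ _), fun h q _ => h q.2⟩

/-! ### The lift -/

/-- **`PolLELift`** (HOME/pnp-psdrank-p2/TARGET.md, T-D.4): every function on perfect matchings
of degree `≤ k` is the restriction of a polynomial of total degree `≤ k` in the edge variables of
`K_n`. [cite: BraunEtAl2016, §4.2–4.3 (pp. 7–8, functions on matchings as ℝ[x]/⟨𝒫_n⟩; Lemma 4.4)] -/
theorem polLELift (n k : ℕ) (f : PMSol n → ℝ) (hf : f ∈ polLE n k) :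
    ∃ G : MvPolynomial (KnEdge n) ℝ, G.totalDegree ≤ k ∧
      ∀ M : PMSol n, f M = MvPolynomial.eval (edgeIndicator M.1) G := by
  refine Submodule.span_induction (p := fun f _ => ∃ G : MvPolynomial (KnEdge n) ℝ,
    G.totalDegree ≤ k ∧ ∀ M : PMSol n, f M = MvPolynomial.eval (edgeIndicator M.1) G)
    ?_ ?_ ?_ ?_ hf
  · rintro _ ⟨Q, hQk, rfl⟩
    by_cases hd : ∃ q ∈ Q, q.IsDiag
    · obtain ⟨q, hq, hqd⟩ := hd
      refine ⟨0, by simp, fun M => ?_⟩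
      rw [monomialFn_eq_zero_of_isDiag hq hqd, map_zero]
      rfl
    · push Not at hd
      refine ⟨monomialPoly Q hd, (totalDegree_monomialPoly_le Q hd).trans hQk, fun M => ?_⟩
      rw [eval_monomialPoly, monomialFn_apply]
  · exact ⟨0, by simp, fun M => by rw [map_zero]; rfl⟩
  · rintro f g - - ⟨F, hF, hfF⟩ ⟨G, hG, hgG⟩
    refine ⟨F + G, (totalDegree_add F G).trans (max_le hF hG), fun M => ?_⟩
    rw [Pi.add_apply, map_add, hfF, hgG]
  · rintro a f - ⟨F, hF, hfF⟩
    refine ⟨a • F, (totalDegree_smul_le a F).trans hF, fun M => ?_⟩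
    rw [Pi.smul_apply, smul_eval, hfF, smul_eq_mul]

end Literature.Combinatorics.Optimization
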